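import Literature.NumberTheory.ComplexMultiplication.CMAlgebraTorusMumfordTateTorus
import Literature.NumberTheory.ComplexMultiplication.CMTorusPrincipalOrder
import Literature.NumberTheory.ComplexMultiplication.CMTypeTorusAbelianVariety
import Literature.Geometry.Kaehler.ComplexTorusHodgeGroupComplexPointsTransport
import HarnessLib

/-!
# The Mumford–Tate group of a complex torus with `K`-multiplication of full degree — Shimura's `(A, ι)` of type `(F)`,
# `[F : ℚ] = 2 dim A`, any order — is an algebraic torus; so is that of every abelian variety isogenous to `ℂ^Φ/Φ(𝔞)`

Topic `Literature/NumberTheory/ComplexMultiplication`, namespace `Literature.NumberTheory.ComplexMultiplication`; lane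
`lit-hodgefound` (Track 2 foundations library), Layer A3 junction row «A3-(MT torus for `(A, ι)` of type `(F)`)»
(self-proposed 2026-08-28, prover seat `lit-hodgefound-p10`, generation 32, FILE 12).  Theorems only (net debt 0).

A JUNCTION file.  The tree has «Milne's Definition 14.9 ⟹ `MT(X)(ℂ)` is a torus» for tori with multiplication by a
CM-ALGEBRA (`IsCMAlgTorusRat.isTorusSubgroup_mumfordTateGroupC`, seat p19), the bridge from Shimura's ONE-FIELD classes
to it (`IsCMAlgTorusRat.of_isCMTorusRat`), and the bridge from the integral class `IsCMTorus` (`𝓞_K` acting) to the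
rational one (`IsCMTorus.isCMTorusRat`, `CMTorusPrincipalOrder`) — but not the composites, which are what a reader holding
Shimura's hypothesis «`(A, ι)` of type `(F)` with `[F : ℚ] = 2n`» wants:

* §1 `IsCMTorusRat.isTorusSubgroup_mumfordTateGroupC` / `…map_toGL_hodgeGroupC` / `IsCMTorusRat.hodgeGroupC_comm`
  (any order `𝔯`), `IsCMTorus.isTorusSubgroup_mumfordTateGroupC` / `…map_toGL_hodgeGroupC` / `IsCMTorus.hodgeGroupC_comm`
  (principal `(A, ι)`): **the Mumford–Tate group of a complex torus with `K`-multiplication of full degree is an algebraic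
  torus and its Hodge group is commutative** — Deligne's «an abelian variety with many complex multiplications is of
  CM-type, so its Mumford–Tate group is a torus», at torus level, for Shimura's `(A, ι)`.
* §2 `isTorusSubgroup_mumfordTateGroupC_of_isIsogenous_periodIso`, `hodgeGroupC_comm_of_isIsogenous_periodIso`: **every
  complex torus ISOGENOUS to a CM torus `ℂ^Φ/Φ(𝔞)` of a CM field has a Mumford–Tate torus** («of CM-type» is an isogeny
  invariant of abelian varieties: `IsIsogenous.exists_comm_isReduced_le_endAlgRat_iff`; `ℂ^Φ/Φ(𝔞)` is an abelian
  variety by Shimura's Theorem 3).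

## References

* [Shimura1998] G. Shimura, *Abelian Varieties with Complex Multiplication and Modular Functions* (1998), §5.2 p. 39,
  §6.1 Thm. 2 p. 41, §6.2 Thm. 3 p. 42, §7.1 p. 50.
* [Deligne1982HodgeCycles] P. Deligne, *Hodge cycles on abelian varieties*, LNM 900 (1982), I §5, p. 63 and Prop. 5.1.
* [Milne2005ShimuraVarieties] J. S. Milne, *Introduction to Shimura Varieties* (2005), §14 Def. 14.9, Prop. 14.10.
* [Gordon1997] B. B. Gordon, *A survey of the Hodge conjecture for abelian varieties*, §2 Prop. 2.12.
* [MoonenZarhin1999LowDim] B. Moonen, Yu. Zarhin, *Hodge classes on abelian varieties of low dimension* (1999), (0.2)(4).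
-/

noncomputable section

open scoped Classical nonZeroDivisors NumberField Matrix MatrixGroups
open Module Matrix NumberField

namespace Literature.NumberTheory.ComplexMultiplication

open Literature.Geometry.Kaehler
open Literature.Geometry.Kaehler.ComplexTorus
open Literature.NumberTheory.Automorphic
open Literature.AlgebraicGeometry.Motives (CMType)

variable {K : Type} [Field K] [NumberField K]
variable {ι : Type} [Fintype ι] [DecidableEq ι] {E : Type} [NormedAddCommGroup E] [NormedSpace ℂ E]
  {P : (ι → ℝ) ≃L[ℝ] E}

/-! ## §1 `(A, ι)` of type `(F)`, `[F : ℚ] = 2 dim A`: `MT` and `Hg` are tori, `Hg` is commutative -/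

namespace IsCMTorusRat

variable {ρ : K →ₐ[ℚ] Matrix ι ι ℚ}

/-- **THE MUMFORD–TATE GROUP OF A COMPLEX TORUS WITH `K`-MULTIPLICATION OF FULL DEGREE IS AN ALGEBRAIC TORUS** — Shimura's
`(A, ι)` of type `(F)` with `[F : ℚ] = 2n` (any order `𝔯`), read as a torus with multiplication by the one-factor
CM-algebra `F` (Milne's Def. 14.9) and fed into «of CM-type ⟹ `MT` is a torus». [cite: Shimura1998, §6.1 Thm. 2, p. 41]
[cite: Deligne1982HodgeCycles, I §5, p. 63] [cite: Milne2005ShimuraVarieties, §14 Def. 14.9 and Prop. 14.10 ((a) ⟹ (c))] -/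
theorem isTorusSubgroup_mumfordTateGroupC (h : IsCMTorusRat P ρ) : IsTorusSubgroup (mumfordTateGroupC P) :=
  (IsCMAlgTorusRat.of_isCMTorusRat h).isTorusSubgroup_mumfordTateGroupC

/-- **… and its Hodge group (read in `GL`) is an algebraic torus.** [cite: Gordon1997, §2 Prop. 2.12 (proof, ⟹)]
[cite: Milne2005ShimuraVarieties, §14 Prop. 14.10 ((a) ⟹ (c))] -/
theorem isTorusSubgroup_map_toGL_hodgeGroupC (h : IsCMTorusRat P ρ) :
    IsTorusSubgroup ((hodgeGroupC P).map Matrix.SpecialLinearGroup.toGL) :=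
  (IsCMAlgTorusRat.of_isCMTorusRat h).isTorusSubgroup_map_toGL_hodgeGroupC

/-- **… and its Hodge group `Hg(X)(ℂ)` is commutative** (on complex points). [cite: Gordon1997, §2 Prop. 2.12]
[cite: Deligne1982HodgeCycles, I §5, p. 63] -/
theorem hodgeGroupC_comm (h : IsCMTorusRat P ρ) {M N : Matrix.SpecialLinearGroup ι ℂ} (hM : M ∈ hodgeGroupC P)
    (hN : N ∈ hodgeGroupC P) : M * N = N * M :=
  hodgeGroupC_comm_of_isTorusSubgroup _ h.isTorusSubgroup_map_toGL_hodgeGroupC hM hN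

/-- Under `(A, ι)` of type `(F)`, `[F : ℚ] = 2n`, `Hg(X)(ℂ)` is conjugate into the diagonal torus («if `Hg(A)` is an
algebraic torus, then it is diagonalizable over `ℂ`»). [cite: Gordon1997, §2 Prop. 2.12 (proof)] -/
theorem exists_forall_conj_mem_diagonalSubgroup (h : IsCMTorusRat P ρ) :
    ∃ Q : GL ι ℂ, ∀ M ∈ hodgeGroupC P, Q * Matrix.SpecialLinearGroup.toGL M * Q⁻¹ ∈ diagonalSubgroup ι ℂ :=
  (IsCMAlgTorusRat.of_isCMTorusRat h).exists_forall_conj_mem_diagonalSubgroup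

end IsCMTorusRat

namespace IsCMTorus

variable {ρ : 𝓞 K →+* Matrix ι ι ℤ}

/-- **THE MUMFORD–TATE GROUP OF A PRINCIPAL `(A, ι)` — a complex torus with `𝓞_K`-multiplication of full degree — IS AN
ALGEBRAIC TORUS** (`ι` extends to `K = ℚ𝓞_K → End_ℚ(X)`, §7.1, and §1 applies). [cite: Shimura1998, §5.2 p. 39, §7.1 p. 50]
[cite: Deligne1982HodgeCycles, I §5, p. 63] [cite: Milne2005ShimuraVarieties, §14 Prop. 14.10 ((a) ⟹ (c))] -/
theorem isTorusSubgroup_mumfordTateGroupC (h : IsCMTorus P ρ) : IsTorusSubgroup (mumfordTateGroupC P) :=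
  h.isCMTorusRat.isTorusSubgroup_mumfordTateGroupC

/-- **… its Hodge group (in `GL`) is an algebraic torus.** [cite: Gordon1997, §2 Prop. 2.12 (proof, ⟹)] -/
theorem isTorusSubgroup_map_toGL_hodgeGroupC (h : IsCMTorus P ρ) :
    IsTorusSubgroup ((hodgeGroupC P).map Matrix.SpecialLinearGroup.toGL) :=
  h.isCMTorusRat.isTorusSubgroup_map_toGL_hodgeGroupC

/-- **… and its Hodge group is commutative.** [cite: Gordon1997, §2 Prop. 2.12] [cite: Deligne1982HodgeCycles, I §5, p. 63] -/
theorem hodgeGroupC_comm (h : IsCMTorus P ρ) {M N : Matrix.SpecialLinearGroup ι ℂ} (hM : M ∈ hodgeGroupC P)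
    (hN : N ∈ hodgeGroupC P) : M * N = N * M :=
  h.isCMTorusRat.hodgeGroupC_comm hM hN

end IsCMTorus

/-! ## §2 The isogeny class of `ℂ^Φ/Φ(𝔞)` (`K` a CM field): Mumford–Tate tori throughout -/

section Isogeny

variable [IsCMField K]

/-- **EVERY COMPLEX TORUS ISOGENOUS TO A CM TORUS `ℂ^Φ/Φ(𝔞)` (`K` a CM field) HAS AN ALGEBRAIC TORUS AS MUMFORD–TATE
GROUP**: `ℂ^Φ/Φ(𝔞)` is an abelian variety (Theorem 3) with `K`-multiplication of full degree (Theorem 2 read backwards),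
«of CM-type» is an isogeny invariant of abelian varieties (an isogeny is an isomorphism of rational Hodge structures), and
«of CM-type ⟹ `MT` a torus». [cite: Shimura1998, §6.1 Thm. 2 p. 41, §6.2 Thm. 3 p. 42] [cite: Deligne1982HodgeCycles, I §5, p. 63]
[cite: MoonenZarhin1999LowDim, (0.2)(4)] [cite: Milne2005ShimuraVarieties, §14 Prop. 14.10] -/
theorem isTorusSubgroup_mumfordTateGroupC_of_isIsogenous_periodIso (Φ : CMType K) (I : (FractionalIdeal (𝓞 K)⁰ K)ˣ)
    (h : IsIsogenous P (CMTypeLattice.periodIso Φ I)) : IsTorusSubgroup (mumfordTateGroupC P) := by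
  have hY : IsAbelianVariety (CMTypeLattice.periodIso Φ I) := CMTypeLattice.isAbelianVariety_periodIso Φ I
  have hX : IsAbelianVariety P := h.isAbelianVariety_iff.2 hY
  rw [hX.isTorusSubgroup_mumfordTateGroupC_iff, h.exists_comm_isReduced_le_endAlgRat_iff hX,
    ← hY.isTorusSubgroup_mumfordTateGroupC_iff]
  exact (CMTypeLattice.isCMTorusRat_periodIso Φ I).isTorusSubgroup_mumfordTateGroupC

/-- **… and a commutative Hodge group.** [cite: Deligne1982HodgeCycles, I §5, p. 63] [cite: Gordon1997, §2 Prop. 2.12]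
[cite: MoonenZarhin1999LowDim, (0.2)(4)] -/
theorem hodgeGroupC_comm_of_isIsogenous_periodIso (Φ : CMType K) (I : (FractionalIdeal (𝓞 K)⁰ K)ˣ)
    (h : IsIsogenous P (CMTypeLattice.periodIso Φ I)) {M N : Matrix.SpecialLinearGroup ι ℂ} (hM : M ∈ hodgeGroupC P)
    (hN : N ∈ hodgeGroupC P) : M * N = N * M :=
  hodgeGroupC_comm_of_isTorusSubgroup _ ((isTorusSubgroup_mumfordTateGroupC_iff_map_toGL_hodgeGroupC P).1
    (isTorusSubgroup_mumfordTateGroupC_of_isIsogenous_periodIso Φ I h)) hM hN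

end Isogeny

end Literature.NumberTheory.ComplexMultiplication

end
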